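import Summits.ABC.IUTFork.Conditional.WRowUnconditionalPackages
import Summits.ABC.IUTFork.Conditional.AbcOfSGenuineKWildInhabitedRow73Packages
import Summits.ABC.IUTFork.Conditional.AbcOfSGenuineKWildInhabitedUCellsB
import HarnessLib

/-!
# R-W WINDOW-TABLE, W1 ROW 7 DECIDED UNCONDITIONALLY (inhabited side): `73 + 2¹³·7⁷·941² = 3¹⁶·103³·127` at `l = 127` — the hull licence S_H HOLDS at EVERY
# genuine Θ-volume datum over `(ratPoint (73/5973865915867209), 127)`, with NO local-type hypothesis

PROOF-ONLY file (D-0012; 0 definitions, 0 `Prop` facts) of the abc-iut cell — D-0079 RESCUE sub-cell R-W «WINDOW Θ-SIDE INEQUALITY», W1 ROW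
DECISIONS seat abc-iut-W-row-2 (gen 2); row 7 of HOME/plan/rescue/R-W/OPEN-10.md (sha16 1b0025ee7a8ba6d7, abc-iut-rw-num-lead):
`pilotDataOfK:frey-73-5973865915867136-5973865915867209:127`. It REMOVES the hypotheses (H) of this seat's gen-0 row theorems
`GenuineK.exists_qPinned_and_hull_chosen_triple_73_l127_of_localType` (p476815) / `…_of_localType_three` (p479390) — the wild local type `e(K_x/ℚ_p) = 30·l` resp. `60·l`
(and the 3-adic different bound) at the bad fibre over `3` — by the recipe of abc-iut-W-row-1 gen 2's rows 1–4 (`WRowFrey283Unconditional*`) /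
abc-iut-w4-d094's row 5 (`WRowFrey343Inhabited`): the bad completions over each bad prime are isometrically `ℚ_p`-isomorphic at `d_mod = 1` (this
seat's `Cor312Prov.nonempty_algEquiv_kOf_of_finrank_eq_one`, `WRow.absRamificationIdx_kOf_eq_of_finrank_eq_one`), so the ramification index is ONE
unknown `e_p` per prime, constrained only by the tree's LOWER bounds (`3810 ∣ e_3`; `1905 ∣ e_{7}`; `1905 ∣ e_{73}`; `635 ∣ e_{103}`; `1905 ∣ e_{941}` — this seat's `AbcOfSGenuineKWildInhabitedRow73Packages` (any level `l`)),
and the socket (`Cor312Prov.licence_settingPrVolSharp_pilotDataOfK_of_orders_rat`, abc-iut-W-row-1 gen 0 over abc-iut-w4-d036's exact cell) is fed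
ONE-SIDED data valid for every such `e`: `D = 2e − 1` at the wild `3` (abc-iut-W-neg-1's `GenuineK.sub_one_div_le_differentOrd_kOf_wild_ratPoint`,
Eisenstein radical of the Tate parameter), `D = e − 1` at the tame poles, `ρin = ⌊e/(p−1)⌋` (abc-iut-c312-5's integer slot, `WRow.inner_witness_slot`)
resp. `1`, `ρout = min(p^a − a·e, p^b − b·e)` (`WRow.outer_member_min`); the integer cells hold for EVERY admissible `e` (`AbcOfSGenuineKWildInhabitedUCellsB`, no case split
over the `63` labels). TAKES NO SIDE on [IUTchIII] Cor. 3.12 (S. Mochizuki, *Inter-universal Teichmüller theory III*, Cor. 3.12 p. 173–174; Step (xi-f)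
p. 184) or on any author; «inhabited as typed» ≠ «asserted in print».

WHAT IS PROVED (namespace `Summit.ABC.IUTFork.Conditional`): **`WRow.licence_frey73_l127_unconditional`** — for EVERY genuine Θ-volume datum `T` at
`(ratPoint (73/5973865915867209), 127)`, EVERY analytic choice of the `p`-adic logarithms and EVERY pair of realising Θ- and q-ideles, abc-iut-c312-1's
`Thm311ToCor312.Licence` HOLDS at `settingPrVolSharp (pilotDataOfK T.D T.K) …`; **`WRow.exists_qPinned_and_hull_frey73_l127`** — hence branch C's
«∃ ρ qK, QPinned ∧ PilotKummerCompatHull» (the per-datum S_H object of the window certificates' binder `hSHwBad`, p453137 / p450130) is INHABITED there,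
for any columns (the gen-0 theorems are the instance `logv := analyticLogv`, ideles := the CHOSEN ones, with (H) deleted).
READING (neutral; numbers, not adjectives): at this Szpiro-BAD admissible-candidate row OUR typed hull clause holds at OUR sharp genuine `K`-setting for
the whole datum class; no number-level and no local-type hypothesis is consumed. Admissibility / (P6) of `(ratPoint λ, 127)` and NON-EMPTINESS of the
datum type are NOT claimed. HONEST SCOPE: OUR sharp containers; STRONGER-THAN-PRINT hull reading; nothing about the printed inequality or any
author's intended hull; typed ≠ proved; instantiated ≠ endorsed; no abc claim.
[cite: Mochizuki2012, IUTchI Def. 3.1 (b),(c) pp. 61–62, Rmk. 3.1.5 p. 65, Ex. 3.2 (iv) p. 71; IUTchIII Cor. 3.12 Step (xi-f) p. 184; IUTchIV Prop. 1.1 p. 9, Prop. 1.2 (i)(ii) p. 10, Prop. 1.4 (ii) p. 13, Cor. 2.2 (ii) proof (P5) p. 46]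
[cite: DupuyHilado2025, §3.3, §3.4, §4.9, §4.12] [cite: NeukirchANT1999, Ch. II (5.5)–(5.7)] [cite: CasselsFrohlichANT1967, Ch. VII Prop. 1.2 (ii)]
[claim: Mochizuki2012, status: disputed] for every IUT sentence.
-/

noncomputable section

open Set Function Metric NumberField IsDedekindDomain

namespace Summit.ABC.IUTFork.Conditional

open Thm311 Thm311.Real Cor312 Cor312Vol Cor312Prov Literature.IUT.LogThetaLattice Literature.IUT.LogVolume
  Literature.IUT.HodgeTheaters Literature.IUT.LogVolume.Cor22
open Literature.NumberTheory.NumberFields Literature.NumberTheory.GaloisRepresentations.Ultrametric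
open Literature.NumberTheory.DiophantineGeometry Literature.NumberTheory.DiophantineGeometry.GenEll

/-! ## THE ROW: S_H INHABITED at every genuine datum over `(ratPoint (73/5973865915867209), 127)` — unconditionally -/

/-- **W1 ROW 7 DECISION, INHABITED SIDE, UNCONDITIONAL — `73 + 2¹³·7⁷·941² = 3¹⁶·103³·127` at `l = 127`.** For EVERY genuine Θ-volume datum `T` at
`(ratPoint (73/5973865915867209), 127)` ([IUTchIV] Cor. 2.2 (ii) proof (P7)) and EVERY pair of Θ- and q-ideles realising the pilot divisors of
`X := pilotDataOfK T.D T.K`, abc-iut-c312-1's `Thm311ToCor312.Licence` HOLDS at abc-iut-c312-7's `settingPrVolSharp X …`. NO local-type and NO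
conjugacy hypothesis: the bad primes are `3, 7, 73, 103, 941` (`WRow.bad_prime_frey73`); the bad completions over each are isometrically `ℚ_p`-isomorphic
(`d_mod = 1`), so the ramification index is a single unknown `e_p` per prime with `e_3 ∈ 3810·ℕ` (wild) and `e_{7} ∈ 1905·ℕ`, `e_{73} ∈ 1905·ℕ`, `e_{103} ∈ 635·ℕ`, `e_{941} ∈ 1905·ℕ` (tame); the socket's
one-sided inputs are `D = 2e − 1`, `ρin = ⌊e/(p−1)⌋` (wild) / `D = e − 1`, `ρin = 1` (tame), `ρout = min(p^a − a·e, p^b − b·e)`, `h = 2·v_p(abc)`;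
the integer cells hold for every such `e` (`AbcOfSGenuineKWildInhabitedUCellsB`). [cite: Mochizuki2012, IUTchI Def. 3.1 (b),(c) pp. 61–62, Rmk. 3.1.5 p. 65, Ex. 3.2 (iv) p. 71; IUTchIII Cor. 3.12 Step (xi-f) p. 184; IUTchIV Prop. 1.1 p. 9, Prop. 1.2 (i)(ii) p. 10, Prop. 1.4 (ii) p. 13, Cor. 2.2 (ii) proof (P5) p. 46] [cite: DupuyHilado2025, §3.3, §3.4, §4.9, §4.12] [claim: Mochizuki2012, status: disputed] -/
theorem WRow.licence_frey73_l127_unconditional (T : Cor22.ThetaVolumeDatumAt (ratPoint (((73 : ℕ) : ℚ) / (5973865915867209 : ℕ))) 127) :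
    letI := T.instFieldF; letI := T.instNumberFieldF; letI := T.instAlgebraF; letI := T.instFieldK
    letI := T.instNumberFieldK; letI := T.instAlgebraK; letI := T.instFieldFbar; letI := T.instAlgebraFbar
    letI := T.instAlgebraKFbar; letI := T.instIsElliptic
    ∀ {logv : PadicLogs T.K} (hlog : LogvAnalytic logv) (M : Type) [Field M] [NumberField M]
      (archPk : ∀ (j : (thetaIndex (pilotDataOfK T.D T.K)).Label) (vQ : (thetaIndex (pilotDataOfK T.D T.K)).VQ),
        Set ((logShellsDH (pilotDataOfK T.D T.K) logv).Packet j vQ))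
      (archSub : ∀ (j : (thetaIndex (pilotDataOfK T.D T.K)).Label) (v : (thetaIndex (pilotDataOfK T.D T.K)).V),
        Set ((logShellsDH (pilotDataOfK T.D T.K) logv).Packet j ((thetaIndex (pilotDataOfK T.D T.K)).over v)))
      (Ψ : ℤ → ∀ v : (thetaIndex (pilotDataOfK T.D T.K)).V, v ∈ (thetaIndex (pilotDataOfK T.D T.K)).Vbad →
        Set ((logShellsDH (pilotDataOfK T.D T.K) logv).StarPacket v))
      (act : ℤ → ∀ v : (thetaIndex (pilotDataOfK T.D T.K)).V, v ∈ (thetaIndex (pilotDataOfK T.D T.K)).Vbad →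
        (logShellsDH (pilotDataOfK T.D T.K) logv).StarPacket v → Module.End ℚ ((logShellsDH (pilotDataOfK T.D T.K) logv).StarPacket v))
      (Mmod : ℤ → ∀ j : (thetaIndex (pilotDataOfK T.D T.K)).LabelStar, Set ((logShellsDH (pilotDataOfK T.D T.K) logv).GlobalPacket j.1))
      (region : ℤ → ∀ j : (thetaIndex (pilotDataOfK T.D T.K)).LabelStar, FinDivisor M → ∀ vQ : (thetaIndex (pilotDataOfK T.D T.K)).VQ,
        Set ((logShellsDH (pilotDataOfK T.D T.K) logv).Packet j.1 vQ))
      (n : ℤ) {HT : Type} {LogLink : HT → HT → Type} {IsFull : ∀ {s t : HT}, LogLink s t → Prop}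
      (lat : LGPGaussianLogThetaLattice LogLink IsFull)
      {Frd : Type} {IsoF : Frd → Frd → Type} {Ob : Frd → Type} {realify : Frd → Frd} {Strip : Type}
      {IsoS : Strip → Strip → Type} {Mv : ∀ v : (thetaIndex (pilotDataOfK T.D T.K)).V, v ∈ (thetaIndex (pilotDataOfK T.D T.K)).Vbad → Type}
      [∀ v h, Monoid (Mv v h)]
      (sig : GlobalLGPFrobenioidSignature (thetaIndex (pilotDataOfK T.D T.K)).lstar (thetaIndex (pilotDataOfK T.D T.K)).V
        (· ∈ (thetaIndex (pilotDataOfK T.D T.K)).Vbad) Frd IsoF Ob realify Strip IsoS Mv)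
      (split : SplittingMonoids Mv) {ObΔ : Type} {N : ∀ v : (thetaIndex (pilotDataOfK T.D T.K)).V, v ∈ (thetaIndex (pilotDataOfK T.D T.K)).Vbad → Type}
      [∀ v h, Monoid (N v h)] (qData : QPilotData ObΔ N)
      (tq : ∀ (pp : Nat.Primes) (x : (thetaIndex (pilotDataOfK T.D T.K)).Fibre (.inr pp)),
        haveI : Fact (pp : ℕ).Prime := ⟨pp.2⟩; kOf (pilotDataOfK T.D T.K) pp.1 x)
      (t : ∀ (pp : Nat.Primes) (_ : Fin (pilotDataOfK T.D T.K).lstar) (x : (thetaIndex (pilotDataOfK T.D T.K)).Fibre (.inr pp)),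
        haveI : Fact (pp : ℕ).Prime := ⟨pp.2⟩; kOf (pilotDataOfK T.D T.K) pp.1 x)
      (htq0 : ∀ pp x, tq pp x ≠ 0)
      (htq1 : ∀ (pp : Nat.Primes) (x : (thetaIndex (pilotDataOfK T.D T.K)).Fibre (.inr pp)),
        haveI : Fact (pp : ℕ).Prime := ⟨pp.2⟩; placeOf (pilotDataOfK T.D T.K) pp.1 x ∉ (pilotDataOfK T.D T.K).S → ‖tq pp x‖ = 1)
      (_ht0 : ∀ pp i x, t pp i x ≠ 0)
      (_ht : ∀ (pp : Nat.Primes) (i : Fin (pilotDataOfK T.D T.K).lstar) (x : (thetaIndex (pilotDataOfK T.D T.K)).Fibre (.inr pp)),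
        haveI : Fact (pp : ℕ).Prime := ⟨pp.2⟩
        Real.log ‖t pp i x‖ = -((pilotDataOfK T.D T.K).thetaPilot i (placeOf (pilotDataOfK T.D T.K) pp.1 x)) *
          logNorm T.K (placeOf (pilotDataOfK T.D T.K) pp.1 x) / localDegree T.K (placeOf (pilotDataOfK T.D T.K) pp.1 x))
      (_htq : ∀ (pp : Nat.Primes) (x : (thetaIndex (pilotDataOfK T.D T.K)).Fibre (.inr pp)),
        haveI : Fact (pp : ℕ).Prime := ⟨pp.2⟩
        Real.log ‖tq pp x‖ = -((pilotDataOfK T.D T.K).qPilot (placeOf (pilotDataOfK T.D T.K) pp.1 x)) *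
          logNorm T.K (placeOf (pilotDataOfK T.D T.K) pp.1 x) / localDegree T.K (placeOf (pilotDataOfK T.D T.K) pp.1 x)),
      Thm311ToCor312.Licence
        (settingPrVolSharp (pilotDataOfK T.D T.K) hlog M archPk archSub Ψ act Mmod region n lat sig split qData tq t htq0 htq1) := by
  classical
  letI := T.instFieldF; letI := T.instNumberFieldF; letI := T.instAlgebraF; letI := T.instFieldK
  letI := T.instNumberFieldK; letI := T.instAlgebraK; letI := T.instFieldFbar; letI := T.instAlgebraFbar
  letI := T.instAlgebraKFbar; letI := T.instIsElliptic
  intro logv hlog M _ _ archPk archSub Ψ act Mmod region n HT LogLink IsFull lat Frd IsoF Ob realify Strip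
    IsoS Mv _ sig split ObΔ N _ qData tq t htq0 htq1 ht0 ht htq
  have hjF : T.E.j = ((jInv (((73 : ℕ) : ℚ) / (5973865915867209 : ℕ)) : ℚ) : T.F) := by rw [T.j_eq]; exact eq_ratCast _ _
  have hlstar : (pilotDataOfK T.D T.K).lstar = 63 := by
    show ((pilotDataOfK T.D T.K).l - 1) / 2 = 63
    rw [pilotDataOfK_l]
  -- `d_mod = 1`: conjugate, isometric bad fibres
  have hFm : Module.finrank ℚ (fieldOfModuli T.E) = 1 := by
    rw [T.finrank_rat_fieldOfModuli_eq_dmod]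
    exact dmod_eq_one_of_degree_le_one (by rw [degree_ratPoint])
  -- the per-prime data (e, D, h, ρin, ρout): `e` is the ACTUAL (unknown) index at some bad fibre point
  set eF : Nat.Primes → ℕ := fun pp =>
    haveI : Fact (pp : ℕ).Prime := ⟨pp.2⟩
    if h : ∃ x : (thetaIndex (pilotDataOfK T.D T.K)).Fibre (.inr pp), placeOf (pilotDataOfK T.D T.K) pp.1 x ∈ (pilotDataOfK T.D T.K).S
    then absRamificationIdx (pp : ℕ) (kOf (pilotDataOfK T.D T.K) pp.1 h.choose) else 1 with heF
  set DF : Nat.Primes → ℕ := fun pp => if (pp : ℕ) = 3 then 2 * eF pp - 1 else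
      eF pp - 1 with hDF
  set hF : Nat.Primes → ℕ := fun pp => if (pp : ℕ) = 2 then 26 else if (pp : ℕ) = 3 then 32 else if (pp : ℕ) = 7 then 14 else
      if (pp : ℕ) = 73 then 2 else if (pp : ℕ) = 103 then 6 else if (pp : ℕ) = 127 then 2 else 4 with hhF
  set rinF : Nat.Primes → ℤ := fun pp => if (pp : ℕ) = 3 then ((eF pp / 2 : ℕ) : ℤ) else
      1 with hrinF
  set routF : Nat.Primes → ℤ := fun pp => if (pp : ℕ) = 3 then min ((3 : ℤ) ^ 7 - 7 * (eF pp : ℤ)) ((3 : ℤ) ^ 8 - 8 * (eF pp : ℤ)) else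
      if (pp : ℕ) = 7 then min ((7 : ℤ) ^ 3 - 3 * (eF pp : ℤ)) ((7 : ℤ) ^ 4 - 4 * (eF pp : ℤ)) else
      if (pp : ℕ) = 73 then min ((73 : ℤ) ^ 1 - 1 * (eF pp : ℤ)) ((73 : ℤ) ^ 2 - 2 * (eF pp : ℤ)) else
      if (pp : ℕ) = 103 then min ((103 : ℤ) ^ 1 - 1 * (eF pp : ℤ)) ((103 : ℤ) ^ 2 - 2 * (eF pp : ℤ)) else
      min ((941 : ℤ) ^ 1 - 1 * (eF pp : ℤ)) ((941 : ℤ) ^ 2 - 2 * (eF pp : ℤ)) with hroutF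
  -- at a bad fibre point `x | p`: `e(K_x) = eF p`
  have heq : ∀ (pp : Nat.Primes) (x : (thetaIndex (pilotDataOfK T.D T.K)).Fibre (.inr pp)),
      haveI : Fact (pp : ℕ).Prime := ⟨pp.2⟩
      placeOf (pilotDataOfK T.D T.K) pp.1 x ∈ (pilotDataOfK T.D T.K).S →
        absRamificationIdx (pp : ℕ) (kOf (pilotDataOfK T.D T.K) pp.1 x) = eF pp := by
    intro pp x hx
    haveI : Fact (pp : ℕ).Prime := ⟨pp.2⟩
    have hex : ∃ x : (thetaIndex (pilotDataOfK T.D T.K)).Fibre (.inr pp),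
        placeOf (pilotDataOfK T.D T.K) pp.1 x ∈ (pilotDataOfK T.D T.K).S := ⟨x, hx⟩
    have h1 : eF pp = absRamificationIdx (pp : ℕ) (kOf (pilotDataOfK T.D T.K) pp.1 hex.choose) := by
      simp only [heF, dif_pos hex]
    rw [h1]
    exact WRow.absRamificationIdx_kOf_eq_of_finrank_eq_one T.D hFm pp x hex.choose
  -- the admissible shape of `e` at each bad prime: `e = e₀·m`, `m ≥ 1`, and `127 ∣ e`
  have hshape : ∀ (pp : Nat.Primes) (x : (thetaIndex (pilotDataOfK T.D T.K)).Fibre (.inr pp)),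
      haveI : Fact (pp : ℕ).Prime := ⟨pp.2⟩
      placeOf (pilotDataOfK T.D T.K) pp.1 x ∈ (pilotDataOfK T.D T.K).S →
        127 ∣ eF pp ∧ ∃ m : ℕ, 1 ≤ m ∧ eF pp = (if (pp : ℕ) = 3 then 3810 else if (pp : ℕ) = 7 then 1905 else
          if (pp : ℕ) = 73 then 1905 else
          if (pp : ℕ) = 103 then 635 else
          1905) * m := by
    intro pp x hx
    haveI : Fact (pp : ℕ).Prime := ⟨pp.2⟩
    have hE := heq pp x hx
    have hpos := absRamificationIdx_pos (pp : ℕ) (kOf (pilotDataOfK T.D T.K) pp.1 x)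
    obtain ⟨hpl, hcases⟩ := WRow.bad_prime_frey73 T pp x hx
    have hd := WRow.dvd_absRamificationIdx_frey73 T pp hpl x
    rw [hE] at hpos hd
    rcases hcases with ⟨hp, -⟩ | ⟨hp, -⟩ | ⟨hp, -⟩ | ⟨hp, -⟩ | ⟨hp, -⟩ | ⟨hp, -⟩
    · simp only [hp] at hd ⊢
      norm_num at hd ⊢
      refine ⟨by omega, eF pp / 3810, by omega, by omega⟩
    · simp only [hp] at hd ⊢
      norm_num at hd ⊢
      refine ⟨by omega, eF pp / 1905, by omega, by omega⟩
    · simp only [hp] at hd ⊢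
      norm_num at hd ⊢
      refine ⟨by omega, eF pp / 1905, by omega, by omega⟩
    · simp only [hp] at hd ⊢
      norm_num at hd ⊢
      refine ⟨by omega, eF pp / 635, by omega, by omega⟩
    · exact absurd hp hpl
    · simp only [hp] at hd ⊢
      norm_num at hd ⊢
      refine ⟨by omega, eF pp / 1905, by omega, by omega⟩
  refine Cor312Prov.licence_settingPrVolSharp_pilotDataOfK_of_orders_rat T.D hlog M archPk archSub Ψ act Mmod region n lat sig split qData
    tq t htq0 htq1 ht0 ht htq (jInv (((73 : ℕ) : ℚ) / (5973865915867209 : ℕ))) hjF eF DF hF rinF routF (fun pp x hx => ?_)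
    (fun pp x y _ _ => Cor312Prov.nonempty_algEquiv_kOf_of_finrank_eq_one T.D hFm pp x y) (fun pp hpp i => ?_)
  · -- the local packages at a bad place `x | p`
    haveI : Fact (pp : ℕ).Prime := ⟨pp.2⟩
    have hE := heq pp x hx
    obtain ⟨hl, m, hm1, hm⟩ := hshape pp x hx
    obtain ⟨hpl, hcases⟩ := WRow.bad_prime_frey73 T pp x hx
    have hne : ∀ c : ℕ, (eF pp : ℤ) ≠ (((pp : ℕ) : ℕ) : ℤ) ^ c * ((((pp : ℕ) : ℕ) : ℤ) - 1) := by
      refine WRow.natCast_ne_pow_mul_sub_one (by norm_num : Nat.Prime 127) pp.2 (fun h => hpl h.symm) (fun h => ?_) hl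
      rcases hcases with ⟨hp, -⟩ | ⟨hp, -⟩ | ⟨hp, -⟩ | ⟨hp, -⟩ | ⟨hp, -⟩ | ⟨hp, -⟩ <;> simp only [hp] at h <;> omega
    rcases hcases with ⟨hp, hord⟩ | ⟨hp, hord⟩ | ⟨hp, hord⟩ | ⟨hp, hord⟩ | ⟨hp, hord⟩ | ⟨hp, hord⟩
    · -- `p = 3`: `e = 3810·m`
      simp only [hp] at hm; norm_num at hm
      have h3 : hF pp = 32 := by simp [hhF, hp]
      refine ⟨hE, ?_, ?_, ?_, by rw [h3]; simpa using hord, by rw [h3, hm]; omega⟩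
      · have hd := GenuineK.sub_one_div_le_differentOrd_kOf_wild_ratPoint T pp (by rw [hp]; norm_num) (by rw [hp]; norm_num)
          (t := 16) (by norm_num) (by rw [hp]; norm_num)
          (fun v hv => by rw [WRow.ord_jInv_frey73 v hv (by rw [hp]; norm_num), hp]; norm_num) x
        rw [hE] at hd
        rw [show DF pp = 2 * eF pp - 1 by simp [hDF, hp]]
        exact hd
      · exact WRow.inner_witness_slot (pp : ℕ) (by rw [hp]; norm_num) hE (show rinF pp = _ by simp [hrinF, hp])
      · exact WRow.outer_member_min (pp : ℕ) hE hne 7 8 (show (((pp : ℕ) : ℕ) : ℤ) = 3 by exact_mod_cast hp)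
          (by simp [hroutF, hp])
    · -- `p = 7`: `e = 1905·m`
      simp only [hp] at hm; norm_num at hm
      have h3 : hF pp = 14 := by simp [hhF, hp]
      refine ⟨hE, ?_, ?_, ?_, by rw [h3]; simpa using hord, by rw [h3, hm]; omega⟩
      · rw [show DF pp = eF pp - 1 by simp [hDF, hp]]
        exact Cor312Prov.pred_div_le_differentOrd_of_eq (pp : ℕ) hE
      · rw [show rinF pp = 1 by simp [hrinF, hp]]
        exact WRow.inner_witness_trivial (pp : ℕ) _ (eF pp)
      · exact WRow.outer_member_min (pp : ℕ) hE hne 3 4 (show (((pp : ℕ) : ℕ) : ℤ) = 7 by exact_mod_cast hp)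
          (by simp [hroutF, hp])
    · -- `p = 73`: `e = 1905·m`
      simp only [hp] at hm; norm_num at hm
      have h3 : hF pp = 2 := by simp [hhF, hp]
      refine ⟨hE, ?_, ?_, ?_, by rw [h3]; simpa using hord, by rw [h3, hm]; omega⟩
      · rw [show DF pp = eF pp - 1 by simp [hDF, hp]]
        exact Cor312Prov.pred_div_le_differentOrd_of_eq (pp : ℕ) hE
      · rw [show rinF pp = 1 by simp [hrinF, hp]]
        exact WRow.inner_witness_trivial (pp : ℕ) _ (eF pp)
      · exact WRow.outer_member_min (pp : ℕ) hE hne 1 2 (show (((pp : ℕ) : ℕ) : ℤ) = 73 by exact_mod_cast hp)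
          (by simp [hroutF, hp])
    · -- `p = 103`: `e = 635·m`
      simp only [hp] at hm; norm_num at hm
      have h3 : hF pp = 6 := by simp [hhF, hp]
      refine ⟨hE, ?_, ?_, ?_, by rw [h3]; simpa using hord, by rw [h3, hm]; omega⟩
      · rw [show DF pp = eF pp - 1 by simp [hDF, hp]]
        exact Cor312Prov.pred_div_le_differentOrd_of_eq (pp : ℕ) hE
      · rw [show rinF pp = 1 by simp [hrinF, hp]]
        exact WRow.inner_witness_trivial (pp : ℕ) _ (eF pp)
      · exact WRow.outer_member_min (pp : ℕ) hE hne 1 2 (show (((pp : ℕ) : ℕ) : ℤ) = 103 by exact_mod_cast hp)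
          (by simp [hroutF, hp])
    · exact absurd hp hpl
    · -- `p = 941`: `e = 1905·m`
      simp only [hp] at hm; norm_num at hm
      have h3 : hF pp = 4 := by simp [hhF, hp]
      refine ⟨hE, ?_, ?_, ?_, by rw [h3]; simpa using hord, by rw [h3, hm]; omega⟩
      · rw [show DF pp = eF pp - 1 by simp [hDF, hp]]
        exact Cor312Prov.pred_div_le_differentOrd_of_eq (pp : ℕ) hE
      · rw [show rinF pp = 1 by simp [hrinF, hp]]
        exact WRow.inner_witness_trivial (pp : ℕ) _ (eF pp)
      · exact WRow.outer_member_min (pp : ℕ) hE hne 1 2 (show (((pp : ℕ) : ℕ) : ℤ) = 941 by exact_mod_cast hp)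
          (by simp [hroutF, hp])
  · -- the integer cells at every label `j = i + 1 ≤ 63`
    haveI : Fact (pp : ℕ).Prime := ⟨pp.2⟩
    obtain ⟨x, hx⟩ := hpp
    have hi : (i : ℕ) < 63 := hlstar ▸ i.isLt
    generalize hk : (i : ℕ) = k at hi ⊢
    obtain ⟨-, m, hm1, hm⟩ := hshape pp x hx
    obtain ⟨hpl, hcases⟩ := WRow.bad_prime_frey73 T pp x hx
    rcases hcases with ⟨hp, -⟩ | ⟨hp, -⟩ | ⟨hp, -⟩ | ⟨hp, -⟩ | ⟨hp, -⟩ | ⟨hp, -⟩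
    · simp only [hp] at hm; norm_num at hm
      have h2 : DF pp = 2 * (3810 * m) - 1 := by simp [hDF, hp, hm]
      have h3 : hF pp = 32 := by simp [hhF, hp]
      have h4 : rinF pp = (((3810 * m / 2 : ℕ) : ℤ)) := by simp [hrinF, hp, hm]
      have h5 : routF pp = min ((3 : ℤ) ^ 7 - 7 * (eF pp : ℤ)) ((3 : ℤ) ^ 8 - 8 * (eF pp : ℤ)) := by
        simp [hroutF, hp]
      rw [h2, h3, h4, h5, hm]
      exact WRow.ucell_frey73_l127_p3 hm1 k hi
    · simp only [hp] at hm; norm_num at hm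
      have h2 : DF pp = 1905 * m - 1 := by simp [hDF, hp, hm]
      have h3 : hF pp = 14 := by simp [hhF, hp]
      have h4 : rinF pp = (1 : ℤ) := by simp [hrinF, hp]
      have h5 : routF pp = min ((7 : ℤ) ^ 3 - 3 * (eF pp : ℤ)) ((7 : ℤ) ^ 4 - 4 * (eF pp : ℤ)) := by
        simp [hroutF, hp]
      rw [h2, h3, h4, h5, hm]
      exact WRow.ucell_frey73_l127_p7 hm1 k hi
    · simp only [hp] at hm; norm_num at hm
      have h2 : DF pp = 1905 * m - 1 := by simp [hDF, hp, hm]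
      have h3 : hF pp = 2 := by simp [hhF, hp]
      have h4 : rinF pp = (1 : ℤ) := by simp [hrinF, hp]
      have h5 : routF pp = min ((73 : ℤ) ^ 1 - 1 * (eF pp : ℤ)) ((73 : ℤ) ^ 2 - 2 * (eF pp : ℤ)) := by
        simp [hroutF, hp]
      rw [h2, h3, h4, h5, hm]
      exact WRow.ucell_frey73_l127_p73 hm1 k hi
    · simp only [hp] at hm; norm_num at hm
      have h2 : DF pp = 635 * m - 1 := by simp [hDF, hp, hm]
      have h3 : hF pp = 6 := by simp [hhF, hp]
      have h4 : rinF pp = (1 : ℤ) := by simp [hrinF, hp]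
      have h5 : routF pp = min ((103 : ℤ) ^ 1 - 1 * (eF pp : ℤ)) ((103 : ℤ) ^ 2 - 2 * (eF pp : ℤ)) := by
        simp [hroutF, hp]
      rw [h2, h3, h4, h5, hm]
      exact WRow.ucell_frey73_l127_p103 hm1 k hi
    · exact absurd hp hpl
    · simp only [hp] at hm; norm_num at hm
      have h2 : DF pp = 1905 * m - 1 := by simp [hDF, hp, hm]
      have h3 : hF pp = 4 := by simp [hhF, hp]
      have h4 : rinF pp = (1 : ℤ) := by simp [hrinF, hp]
      have h5 : routF pp = min ((941 : ℤ) ^ 1 - 1 * (eF pp : ℤ)) ((941 : ℤ) ^ 2 - 2 * (eF pp : ℤ)) := by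
        simp [hroutF, hp]
      rw [h2, h3, h4, h5, hm]
      exact WRow.ucell_frey73_l127_p941 hm1 k hi

/-- **BRANCH C's PER-DATUM ANTECEDENT «∃ ρ qK, QPinned ∧ PilotKummerCompatHull» INHABITED at every genuine datum over `(ratPoint (73/5973865915867209), 127)`**
(any columns `col`; every analytic `logv`; every pair of realising Θ- and q-ideles, the CHOSEN ones of the window certificates' `hSHw`/`hSHwBad` binders
included — abc-iut-w5-d009's `exists_qPinned_and_hull_settingPrVolSharp_iff_licence`, realising q-ideles having norm `≤ 1`): the per-datum S_H object of
the certificates of record (p453137 / p450130 / p447945) HOLDS at this datum class, UNCONDITIONALLY — this seat's gen-0 row theorem with its local-type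
hypotheses DELETED. [cite: Mochizuki2012, IUTchIII Cor. 3.12 Step (xi-d) p. 183, (xi-f) p. 184] [cite: DupuyHilado2025, §3.3, §3.4, §4.9]
[claim: Mochizuki2012, status: disputed] -/
theorem WRow.exists_qPinned_and_hull_frey73_l127 (T : Cor22.ThetaVolumeDatumAt (ratPoint (((73 : ℕ) : ℚ) / (5973865915867209 : ℕ))) 127) :
    letI := T.instFieldF; letI := T.instNumberFieldF; letI := T.instAlgebraF; letI := T.instFieldK
    letI := T.instNumberFieldK; letI := T.instAlgebraK; letI := T.instFieldFbar; letI := T.instAlgebraFbar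
    letI := T.instAlgebraKFbar; letI := T.instIsElliptic
    ∀ {logv : PadicLogs T.K} (hlog : LogvAnalytic logv) (M : Type) [Field M] [NumberField M]
      (archPk : ∀ (j : (thetaIndex (pilotDataOfK T.D T.K)).Label) (vQ : (thetaIndex (pilotDataOfK T.D T.K)).VQ),
        Set ((logShellsDH (pilotDataOfK T.D T.K) logv).Packet j vQ))
      (archSub : ∀ (j : (thetaIndex (pilotDataOfK T.D T.K)).Label) (v : (thetaIndex (pilotDataOfK T.D T.K)).V),
        Set ((logShellsDH (pilotDataOfK T.D T.K) logv).Packet j ((thetaIndex (pilotDataOfK T.D T.K)).over v)))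
      (Ψ : ℤ → ∀ v : (thetaIndex (pilotDataOfK T.D T.K)).V, v ∈ (thetaIndex (pilotDataOfK T.D T.K)).Vbad →
        Set ((logShellsDH (pilotDataOfK T.D T.K) logv).StarPacket v))
      (act : ℤ → ∀ v : (thetaIndex (pilotDataOfK T.D T.K)).V, v ∈ (thetaIndex (pilotDataOfK T.D T.K)).Vbad →
        (logShellsDH (pilotDataOfK T.D T.K) logv).StarPacket v → Module.End ℚ ((logShellsDH (pilotDataOfK T.D T.K) logv).StarPacket v))
      (Mmod : ℤ → ∀ j : (thetaIndex (pilotDataOfK T.D T.K)).LabelStar, Set ((logShellsDH (pilotDataOfK T.D T.K) logv).GlobalPacket j.1))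
      (region : ℤ → ∀ j : (thetaIndex (pilotDataOfK T.D T.K)).LabelStar, FinDivisor M → ∀ vQ : (thetaIndex (pilotDataOfK T.D T.K)).VQ,
        Set ((logShellsDH (pilotDataOfK T.D T.K) logv).Packet j.1 vQ))
      (n : ℤ) {HT : Type} {LogLink : HT → HT → Type} {IsFull : ∀ {s t : HT}, LogLink s t → Prop}
      (lat : LGPGaussianLogThetaLattice LogLink IsFull)
      {Frd : Type} {IsoF : Frd → Frd → Type} {Ob : Frd → Type} {realify : Frd → Frd} {Strip : Type}
      {IsoS : Strip → Strip → Type} {Mv : ∀ v : (thetaIndex (pilotDataOfK T.D T.K)).V, v ∈ (thetaIndex (pilotDataOfK T.D T.K)).Vbad → Type}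
      [∀ v h, Monoid (Mv v h)]
      (sig : GlobalLGPFrobenioidSignature (thetaIndex (pilotDataOfK T.D T.K)).lstar (thetaIndex (pilotDataOfK T.D T.K)).V
        (· ∈ (thetaIndex (pilotDataOfK T.D T.K)).Vbad) Frd IsoF Ob realify Strip IsoS Mv)
      (split : SplittingMonoids Mv) {ObΔ : Type} {N : ∀ v : (thetaIndex (pilotDataOfK T.D T.K)).V, v ∈ (thetaIndex (pilotDataOfK T.D T.K)).Vbad → Type}
      [∀ v h, Monoid (N v h)] (qData : QPilotData ObΔ N)
      (tq : ∀ (pp : Nat.Primes) (x : (thetaIndex (pilotDataOfK T.D T.K)).Fibre (.inr pp)),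
        haveI : Fact (pp : ℕ).Prime := ⟨pp.2⟩; kOf (pilotDataOfK T.D T.K) pp.1 x)
      (t : ∀ (pp : Nat.Primes) (_ : Fin (pilotDataOfK T.D T.K).lstar) (x : (thetaIndex (pilotDataOfK T.D T.K)).Fibre (.inr pp)),
        haveI : Fact (pp : ℕ).Prime := ⟨pp.2⟩; kOf (pilotDataOfK T.D T.K) pp.1 x)
      (htq0 : ∀ pp x, tq pp x ≠ 0)
      (htq1 : ∀ (pp : Nat.Primes) (x : (thetaIndex (pilotDataOfK T.D T.K)).Fibre (.inr pp)),
        haveI : Fact (pp : ℕ).Prime := ⟨pp.2⟩; placeOf (pilotDataOfK T.D T.K) pp.1 x ∉ (pilotDataOfK T.D T.K).S → ‖tq pp x‖ = 1)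
      (col : ℤ → Column (logShellsDH (pilotDataOfK T.D T.K) logv))
      (_ht0 : ∀ pp i x, t pp i x ≠ 0)
      (_ht : ∀ (pp : Nat.Primes) (i : Fin (pilotDataOfK T.D T.K).lstar) (x : (thetaIndex (pilotDataOfK T.D T.K)).Fibre (.inr pp)),
        haveI : Fact (pp : ℕ).Prime := ⟨pp.2⟩
        Real.log ‖t pp i x‖ = -((pilotDataOfK T.D T.K).thetaPilot i (placeOf (pilotDataOfK T.D T.K) pp.1 x)) *
          logNorm T.K (placeOf (pilotDataOfK T.D T.K) pp.1 x) / localDegree T.K (placeOf (pilotDataOfK T.D T.K) pp.1 x))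
      (_htq : ∀ (pp : Nat.Primes) (x : (thetaIndex (pilotDataOfK T.D T.K)).Fibre (.inr pp)),
        haveI : Fact (pp : ℕ).Prime := ⟨pp.2⟩
        Real.log ‖tq pp x‖ = -((pilotDataOfK T.D T.K).qPilot (placeOf (pilotDataOfK T.D T.K) pp.1 x)) *
          logNorm T.K (placeOf (pilotDataOfK T.D T.K) pp.1 x) / localDegree T.K (placeOf (pilotDataOfK T.D T.K) pp.1 x)),
      ∃ (ρ : (∀ v : (thetaIndex (pilotDataOfK T.D T.K)).V, v ∈ (thetaIndex (pilotDataOfK T.D T.K)).Vbad →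
              Set ((logShellsDH (pilotDataOfK T.D T.K) logv).StarPacket v)) →
            ∀ (j : (thetaIndex (pilotDataOfK T.D T.K)).Label) (vQ : (thetaIndex (pilotDataOfK T.D T.K)).VQ),
              Set ((logShellsDH (pilotDataOfK T.D T.K) logv).Packet j vQ))
          (qK : ∀ v : (thetaIndex (pilotDataOfK T.D T.K)).V, v ∈ (thetaIndex (pilotDataOfK T.D T.K)).Vbad →
            Set ((logShellsDH (pilotDataOfK T.D T.K) logv).StarPacket v)),
          QPinned ({ toSituation := situationPrVol (pilotDataOfK T.D T.K) hlog M archPk archSub Ψ act Mmod region, col := col } :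
              LatticeSituation (thetaIndex (pilotDataOfK T.D T.K)))
            (settingPrVolSharp (pilotDataOfK T.D T.K) hlog M archPk archSub Ψ act Mmod region n lat sig split qData tq t htq0 htq1) ρ qK ∧
          PilotKummerCompatHull ({ toSituation := situationPrVol (pilotDataOfK T.D T.K) hlog M archPk archSub Ψ act Mmod region, col := col } :
              LatticeSituation (thetaIndex (pilotDataOfK T.D T.K)))
            (settingPrVolSharp (pilotDataOfK T.D T.K) hlog M archPk archSub Ψ act Mmod region n lat sig split qData tq t htq0 htq1) ρ qK := by
  letI := T.instFieldF; letI := T.instNumberFieldF; letI := T.instAlgebraF; letI := T.instFieldK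
  letI := T.instNumberFieldK; letI := T.instAlgebraK; letI := T.instFieldFbar; letI := T.instAlgebraFbar
  letI := T.instAlgebraKFbar; letI := T.instIsElliptic
  intro logv hlog M _ _ archPk archSub Ψ act Mmod region n HT LogLink IsFull lat Frd IsoF Ob realify Strip
    IsoS Mv _ sig split ObΔ N _ qData tq t htq0 htq1 col ht0 ht htq
  exact (exists_qPinned_and_hull_settingPrVolSharp_iff_licence (pilotDataOfK T.D T.K) hlog M archPk archSub Ψ act Mmod region n lat sig
    split qData tq t htq0 htq1 col (fun pp x => norm_qIdele_le_one_of_realises (pilotDataOfK T.D T.K) tq htq0 htq pp x)).2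
    (WRow.licence_frey73_l127_unconditional T hlog M archPk archSub Ψ act Mmod region n lat sig split qData tq t htq0 htq1 ht0 ht htq)

end Summit.ABC.IUTFork.Conditional

end
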